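import Literature.AnabelianGeometry.SemiGraphs.TemperedAnabelian
import Literature.AnabelianGeometry.AbsoluteAnabelian.AbsTopIII.KummerFaithfulPadicProofs
import Summits.ABC.IUTFork.LanaKummerAmbient
import HarnessLib

/-!
# L-LANA objects XII quinquies: LANA §4.2 (b) bullet 2 AT A BAD PLACE over the tree's tempered curves — UNCONDITIONAL

Record-only file (D-0012) of the abc-iut cell (seat abc-iut-c312-4, L-LANA level, plan/LLANA-SPEC N5/N9/N13; CONSUMES
layer L3's REAL tempered-curve interface `Literature.AnabelianGeometry.SemiGraphs.TemperedCurve` — [SemiAnbd] §6,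
seat abc-iut-L3-t2 — and layer L4's kernel theorem `divisibleElementsTrivial_units_of_finite_padic`); TAKES NO SIDE
on [IUTchIII] Cor. 3.12. LANA §3.8 (a) p. 20 / §4.2 (b) p. 26: at `v ∈ V^bad`, "`Π_v`" is the tempered fundamental
group of the curve at `v`, with `Π_v ↠ G_v`, and "one can reconstruct … from … `Π_v`: • The topological field `K̄_v`
with the natural continuous action of `Π_v`. • The embedding `K_v^× = (K̄_v^×)^{G_v} ↪ H¹(Π_v, Λ(O^×_v))` by Kummer
theory." For a tempered curve `X` of the tree (base field `K ⊆ ℚ̄_p` finite over `ℚ_p`, `Π := Π^temp_{X_K}`,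
augmentation `aug : Π → G_{ℚ_p}` with image `G_K = K.fixingSubgroup`), over `LanaKummerAmbient.lean`
(`Ω := ℚ̄_p = AlgebraicClosure ℚ_[p]`, `k := ℚ_p`, `ρ := aug`):

* `TemperedCurveRef.kummerEmbedding X : K^× → H¹(Π^temp_{X_K}, Λ(ℚ̄_p^×))` — the printed embedding, `Π^temp`
  acting on `ℚ̄_p^×` through the augmentation; `invariants_iff_mem` — **`(ℚ̄_p^×)^{Π^temp} = K^×`**;
* **`kummerEmbedding_injective` — it IS an embedding, with NO hypothesis**: `⋂_n (K^×)^n = 1` for the finite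
  extension `K/ℚ_p` is L4's `divisibleElementsTrivial_units_of_finite_padic` ([AbsTopIII] Rmk. 1.5.4 (i)); the
  rest is `Ambient.kummerEmbedding_injective_of` (L2-t3 kernel criterion + infinite Galois theory);
* LANA §6.2 (f)–(g) pp. 35 (Steps 5–6: "the decomposition groups `D_t` …", "`Λ_{v,t} := Λ(K̄_{v,t})` … naturally a
  `D_t`-module", "`κ_t … is the local Kummer map"): for a NON-CUSPIDAL closed point `x`, the augmentation is
  INJECTIVE on `D_x` (`aug_injective_decomp`, from [SemiAnbd] p. 71 "`I_x = D_x ∩ Δ^temp_X` is `{1}` if `x` is not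
  a cusp" = L3 field `inertia_eq_bot`), its image `aug(D_x)` is an OPEN (L3 `isOpen_aug_decomp`) hence closed
  subgroup of `G_{ℚ_p}` cutting out a FINITE extension `K_x := ℚ̄_p^{aug(D_x)}` of `ℚ_p` with
  `G_{K_x} = aug(D_x)` (`fixingSubgroup_residueFieldAt`, `finiteDimensional_residueFieldAt` — infinite Galois
  theory), and **the local Kummer map `κ_x : K_x^× → H¹(D_x, Λ(ℚ̄_p^×))` is injective, unconditionally**
  (`kummerEmbeddingDecomp_injective`) — i.e. "`D_t` may be regarded as `G_{K_{v,t}}`" made precise and LANA's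
  hypothesis `hκ` (injective local Kummer maps, `LanaEtaAlgorithm.phiProd_injective`) DISCHARGED at the level of
  the decomposition groups of the tree's tempered curves.

Modelling notes. (i) Cohomology = Mathlib's discrete `groupCohomology.H1` of `Π^temp`/`D_x` (the continuous `H¹`
injects into it — layer L2 `ContH1Discrete`; LANA's `∞H¹` = colimit over open subgroups is the sibling
`LanaKummerTower`'s shape, not repeated here). (ii) Coefficients `Λ(O^×_v) = Λ(ℚ̄_p^×)`. (iii) Which closed points
are the "`x_t` of Figure 1" (torsion points of the special fibre, [IUTchII] §2) is layer L6's datum; here `x` is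
any non-cusp. [cite: LANA2026Report, §4.2 (b) p. 26, §3.8 (a) p. 20, §6.2 (f) p. 35, §6.2 (g) p. 35]
[cite: MochizukiSemiAnbd2006, §6 p.71] NOT here: cusps (`I_x ≅ Ẑ(1)`); any judgement.
-/

noncomputable section

namespace Summit.ABC
namespace IUTFork
namespace TemperedCurveRef

open Literature.AnabelianGeometry.SemiGraphs
open Literature.AnabelianGeometry.EtaleTheta
open Literature.AnabelianGeometry.AbsoluteAnabelian.AbsTopIII (DivisibleElementsTrivial)

variable {p : ℕ} [Fact p.Prime] (X : TemperedCurve p)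

/-! ## 1. The Kummer embedding `K^× ↪ H¹(Π^temp_{X_K}, Λ(ℚ̄_p^×))` -/

/-- The augmentation `Π^temp_{X_K} → G_{ℚ_p}` as a bare homomorphism (the `ρ` of `LanaKummerAmbient`).
[cite: LANA2026Report, §3.8 (a) p. 20] -/
abbrev rho : X.PiTemp →* GQp p := X.aug.toMonoidHom

/-- Its image is `G_K` (L3 field `range_aug`). [cite: MochizukiSemiAnbd2006, §6 p.69] -/
theorem rho_range : (rho X).range = X.K.fixingSubgroup := X.range_aug

/-- **`(ℚ̄_p^×)^{Π^temp_{X_K}} = K^×`**: a unit of `ℚ̄_p` is fixed by `Π^temp` (acting through the augmentation) iff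
it lies in `K` (infinite Galois theory, `Ambient.mem_invariants_viaUnits_iff_mem`).
[cite: LANA2026Report, §4.2 (b) p. 26] -/
theorem invariants_iff_mem (u : Ambient.ViaUnits (rho X)) :
    u ∈ invariants (A := Ambient.ViaUnits (rho X)) (⊤ : Subgroup X.PiTemp) ↔
      (((Ambient.ViaUnits.of (rho X)).symm u : (AlgebraicClosure ℚ_[p])ˣ) : AlgebraicClosure ℚ_[p]) ∈ X.K := by
  haveI : IsGalois ℚ_[p] (AlgebraicClosure ℚ_[p]) := {}
  exact Ambient.mem_invariants_viaUnits_iff_mem (rho X) X.K (rho_range X) u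

/-- **LANA §4.2 (b) bullet 2 for the tree's tempered curve `X`**: the Kummer embedding
`K^× → H¹(Π^temp_{X_K}, Λ(ℚ̄_p^×))`. [cite: LANA2026Report, §4.2 (b) p. 26] -/
def kummerEmbedding :
    Additive (↥X.K)ˣ →+
      groupCohomology.H1 (cyclotomeRep (A := Ambient.ViaUnits (rho X)) (⊤ : Subgroup X.PiTemp)) :=
  Ambient.kummerEmbedding (rho X) X.K (rho_range X).le

/-- **`⋂_n (K^×)^n = 1` for the base field of a tempered curve** (a finite extension of `ℚ_p`): layer L4's
`divisibleElementsTrivial_units_of_finite_padic` ([AbsTopIII] Rmk. 1.5.4 (i)).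
[cite: MochizukiAbsTopIII2015, Rmk 1.5.4 (i) p.33] -/
theorem divisibleElementsTrivial_baseField : DivisibleElementsTrivial (↥X.K)ˣ := by
  haveI : FiniteDimensional ℚ_[p] ↥X.K := X.finiteDimensional_K
  exact Literature.AnabelianGeometry.AbsoluteAnabelian.AbsTopIII.divisibleElementsTrivial_units_of_finite_padic
    p ↥X.K

/-- **The Kummer embedding `K^× ↪ H¹(Π^temp_{X_K}, Λ(ℚ̄_p^×))` is INJECTIVE — no hypothesis.**
[cite: LANA2026Report, §4.2 (b) p. 26] -/
theorem kummerEmbedding_injective : Function.Injective (kummerEmbedding X) := by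
  haveI : IsGalois ℚ_[p] (AlgebraicClosure ℚ_[p]) := {}
  exact Ambient.kummerEmbedding_injective_of (rho X) X.K (rho_range X) (divisibleElementsTrivial_baseField X)

/-- `κ(x) = 0 ⟺ x = 1` on `K^×`. [cite: LANA2026Report, §4.2 (b) p. 26] -/
theorem kummerEmbedding_eq_zero_iff (x : (↥X.K)ˣ) : kummerEmbedding X (Additive.ofMul x) = 0 ↔ x = 1 := by
  haveI : IsGalois ℚ_[p] (AlgebraicClosure ℚ_[p]) := {}
  exact Ambient.kummerEmbedding_eq_zero_iff_of (rho X) X.K (rho_range X) (divisibleElementsTrivial_baseField X) x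

/-! ## 2. Decomposition groups of non-cuspidal points: `D_x ≅ G_{K_x}` and the local Kummer map `κ_x` -/

variable (x : X.Pt)

/-- **The augmentation is injective on the decomposition group of a non-cusp** ([SemiAnbd] p. 71: "`I_x = D_x ∩
Δ^temp_X` is … `{1}` if `x` is not a cusp", L3 field `inertia_eq_bot`). [cite: MochizukiSemiAnbd2006, §6 p.71] -/
theorem aug_injective_decomp (hx : ¬ X.IsCusp x) :
    Function.Injective ((rho X).comp (X.decomp x).subtype) := by
  intro a b h
  have h' : X.aug.toMonoidHom (a : X.PiTemp) = X.aug.toMonoidHom (b : X.PiTemp) := h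
  have hker : ((a : X.PiTemp)⁻¹ * (b : X.PiTemp)) ∈ X.aug.toMonoidHom.ker := by
    rw [MonoidHom.mem_ker, map_mul, map_inv, h', inv_mul_cancel]
  have hmem : ((a : X.PiTemp)⁻¹ * (b : X.PiTemp)) ∈ X.decomp x ⊓ X.aug.toMonoidHom.ker :=
    ⟨(X.decomp x).mul_mem ((X.decomp x).inv_mem a.2) b.2, hker⟩
  rw [X.inertia_eq_bot x hx, Subgroup.mem_bot] at hmem
  exact Subtype.ext (inv_mul_eq_one.mp hmem)

/-- The augmentation restricted to `D_x`, as the `ρ` of `LanaKummerAmbient` for the group `D_x`.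
[cite: LANA2026Report, §6.2 (f) p. 35] -/
abbrev rhoDecomp : ↥(X.decomp x) →* GQp p := (rho X).comp (X.decomp x).subtype

/-- The image `aug(D_x) ≤ G_{ℚ_p}`. [cite: LANA2026Report, §6.2 (f) p. 35] -/
theorem rhoDecomp_range : (rhoDecomp X x).range = (X.decomp x).map (rho X) := by
  rw [MonoidHom.range_comp, Subgroup.range_subtype]

/-- `aug(D_x)` is OPEN in `G_{ℚ_p}` ("`D_x` always surjects onto an open subgroup of `G_K`", [SemiAnbd] p. 71; L3
field `isOpen_aug_decomp`). [cite: MochizukiSemiAnbd2006, §6 p.71] -/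
theorem isOpen_map_decomp : IsOpen (((X.decomp x).map (rho X) : Subgroup (GQp p)) : Set (GQp p)) := by
  have h := X.isOpen_aug_decomp x
  rwa [Subgroup.coe_map]

/-- … hence CLOSED. [folklore] -/
theorem isClosed_map_decomp : IsClosed (((X.decomp x).map (rho X) : Subgroup (GQp p)) : Set (GQp p)) :=
  Subgroup.isClosed_of_isOpen _ (isOpen_map_decomp X x)

/-- `aug(D_x)` as a closed subgroup of `G_{ℚ_p}`. [cite: LANA2026Report, §6.2 (f) p. 35] -/
def decompImage : ClosedSubgroup (GQp p) := ⟨(X.decomp x).map (rho X), isClosed_map_decomp X x⟩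

/-- **`K_x := ℚ̄_p^{aug(D_x)}`**, the field cut out by the decomposition group of `x` (for the points `x_t` of
LANA's Figure 1 this is "`K̄_{v,t}`'s base `K_{v,t}`", §6.2 (g)). [cite: LANA2026Report, §6.2 (g) p. 35] -/
def residueFieldAt : IntermediateField ℚ_[p] (AlgebraicClosure ℚ_[p]) :=
  IntermediateField.fixedField ((X.decomp x).map (rho X))

/-- **`G_{K_x} = aug(D_x)`** (infinite Galois theory for the closed subgroup `aug(D_x)`, Mathlib
`InfiniteGalois.fixingSubgroup_fixedField`). [cite: LANA2026Report, §6.2 (g) p. 35] -/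
theorem fixingSubgroup_residueFieldAt : (residueFieldAt X x).fixingSubgroup = (X.decomp x).map (rho X) := by
  haveI : IsGalois ℚ_[p] (AlgebraicClosure ℚ_[p]) := {}
  exact InfiniteGalois.fixingSubgroup_fixedField (decompImage X x)

/-- So `aug : D_x → G_{ℚ_p}` has image EXACTLY `G_{K_x}` — "`D_t` regarded as `G_{K_{v,t}}`" (injective by
`aug_injective_decomp` for non-cusps). [cite: LANA2026Report, §6.2 (g) p. 35] -/
theorem rhoDecomp_range_eq : (rhoDecomp X x).range = (residueFieldAt X x).fixingSubgroup := by
  rw [rhoDecomp_range, fixingSubgroup_residueFieldAt]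

/-- **`K_x` is a FINITE extension of `ℚ_p`** (`G_{K_x}` is open; Mathlib `InfiniteGalois.isOpen_iff_finite`).
[cite: LANA2026Report, §6.2 (g) p. 35] -/
theorem finiteDimensional_residueFieldAt : FiniteDimensional ℚ_[p] ↥(residueFieldAt X x) := by
  haveI : IsGalois ℚ_[p] (AlgebraicClosure ℚ_[p]) := {}
  refine (InfiniteGalois.isOpen_iff_finite (residueFieldAt X x)).mp ?_
  have h := isOpen_map_decomp X x
  rw [← fixingSubgroup_residueFieldAt] at h
  exact h

/-- **`⋂_n (K_x^×)^n = 1`** (L4, finite extensions of `ℚ_p`). [cite: MochizukiAbsTopIII2015, Rmk 1.5.4 (i) p.33] -/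
theorem divisibleElementsTrivial_residueFieldAt : DivisibleElementsTrivial (↥(residueFieldAt X x))ˣ := by
  haveI := finiteDimensional_residueFieldAt X x
  exact Literature.AnabelianGeometry.AbsoluteAnabelian.AbsTopIII.divisibleElementsTrivial_units_of_finite_padic
    p ↥(residueFieldAt X x)

/-- **The local Kummer map at `x`: `κ_x : K_x^× → H¹(D_x, Λ(ℚ̄_p^×))`**, `D_x` acting on `ℚ̄_p^×` through the
augmentation (LANA §6.2 (g): "`κ_t : O^▷_{v,t} → ∞H¹(D_t, Λ_{v,t})` is the local Kummer map", here on the whole of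
`K_x^×` and at the full group `D_x`). [cite: LANA2026Report, §6.2 (g) p. 35] -/
def kummerEmbeddingDecomp :
    Additive (↥(residueFieldAt X x))ˣ →+
      groupCohomology.H1 (cyclotomeRep (A := Ambient.ViaUnits (rhoDecomp X x)) (⊤ : Subgroup ↥(X.decomp x))) :=
  Ambient.kummerEmbedding (rhoDecomp X x) (residueFieldAt X x) (rhoDecomp_range_eq X x).le

/-- **`κ_x` is INJECTIVE — no hypothesis** (this is the `hκ` of `LanaEtaAlgorithm.phiProd_injective` at the level of
the decomposition groups of the tree's tempered curves). [cite: LANA2026Report, §6.2 (g) p. 36] -/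
theorem kummerEmbeddingDecomp_injective : Function.Injective (kummerEmbeddingDecomp X x) := by
  haveI : IsGalois ℚ_[p] (AlgebraicClosure ℚ_[p]) := {}
  exact Ambient.kummerEmbedding_injective_of (rhoDecomp X x) (residueFieldAt X x) (rhoDecomp_range_eq X x)
    (divisibleElementsTrivial_residueFieldAt X x)

/-- `(ℚ̄_p^×)^{D_x} = K_x^×`. [cite: LANA2026Report, §6.2 (g) p. 35] -/
theorem invariants_decomp_iff_mem (u : Ambient.ViaUnits (rhoDecomp X x)) :
    u ∈ invariants (A := Ambient.ViaUnits (rhoDecomp X x)) (⊤ : Subgroup ↥(X.decomp x)) ↔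
      (((Ambient.ViaUnits.of (rhoDecomp X x)).symm u : (AlgebraicClosure ℚ_[p])ˣ) : AlgebraicClosure ℚ_[p]) ∈
        residueFieldAt X x := by
  haveI : IsGalois ℚ_[p] (AlgebraicClosure ℚ_[p]) := {}
  exact Ambient.mem_invariants_viaUnits_iff_mem (rhoDecomp X x) (residueFieldAt X x) (rhoDecomp_range_eq X x) u

/-- `K ⊆ K_x`: the base field is fixed by `aug(D_x) ≤ G_K`. [cite: LANA2026Report, §6.2 (g) p. 35] -/
theorem baseField_le_residueFieldAt : X.K ≤ residueFieldAt X x := by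
  intro a ha
  rw [residueFieldAt, IntermediateField.mem_fixedField_iff]
  rintro σ ⟨g, -, rfl⟩
  have hg : (rho X) g ∈ X.K.fixingSubgroup := (rho_range X).le ⟨g, rfl⟩
  exact (IntermediateField.mem_fixingSubgroup_iff X.K _).mp hg a ha

end TemperedCurveRef

end IUTFork

end Summit.ABC

end
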